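import Literature.Topology.FourManifolds.IntersectionFormTopology
import Literature.AlgebraicTopology.SingularHomology.IntersectionFormProofs
import HarnessLib

/-!
# `rank H²(M; ℤ)/T = b₂(M)` for closed topological 4-manifolds: proofs for `IntersectionFormTopology`
(spc4.S08, rank part — the named fact `finrank_freeCohomology_two_eq_bettiNumber` is mis-stated;
corrected statement proved here)

Proof file (sibling of `Literature.Topology.FourManifolds.IntersectionFormTopology`; compare the
sibling `…IntersectionFormTopologyProofs` for the orientability remark of spc4.S09) for the rank
part of spc4.S08: for a closed topological 4-manifold `M` the intersection lattice `H²(M; ℤ)/T` has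
rank `b₂(M) = dim_ℚ H₂(M; ℚ)` (J. Milnor, D. Husemoller, *Symmetric Bilinear Forms* (1973), §V.1;
R. Gompf, A. Stipsicz, *4-Manifolds and Kirby Calculus* (1999), §1.2: `rk Q_M = b₂(M)`).

## The named fact is mis-stated as elaborated; what is proved instead

In `IntersectionFormTopology.lean` the fact is written under
`variable {M : Type u} [TopologicalSpace M] [T2Space M] [ChartedSpace (𝔼 4) M] [CompactSpace M]` as
`def finrank_freeCohomology_two_eq_bettiNumber : Prop := Module.finrank ℤ ↥(freeCohomology ℤ M 2) = bettiNumber ℚ M 2`.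
Lean includes a section variable in a *definition* only if the definition uses it, and the body
uses none of `[T2Space M]`, `[ChartedSpace (𝔼 4) M]`, `[CompactSpace M]`; the constant therefore
elaborates as `finrank_freeCohomology_two_eq_bettiNumber : ∀ {M : Type u} [TopologicalSpace M], Prop`
(checked: `@finrank_freeCohomology_two_eq_bettiNumber.{u} : {M : Type u} → [TopologicalSpace M] → Prop`)
— the closed-manifold hypotheses of the docstring were silently dropped by the D-0014 rewrite of
the interim theorem into a `def`.  So stated, "for every topological space `M`,
`rank (H²(M; ℤ)/T) = dim_ℚ H₂(M; ℚ)`", it is false: for the Moore space `X = M(ℚ, 2)` (the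
mapping telescope of the degree-`n` self-maps of `S²`; `H₁(X; ℤ) = 0`, `H₂(X; ℤ) ≅ ℚ`) the universal
coefficient theorem gives `H²(X; ℤ) ≅ Hom(ℚ, ℤ) ⊕ Ext(0, ℤ) = 0`, so the left side is `0`, while
`H₂(X; ℚ) ≅ ℚ ⊗ ℚ ≅ ℚ` makes the right side `1` (Hatcher 2002, §3.1 Thm. 3.2, §3.A Cor. 3A.6; the
statement does hold whenever `H₁` and `H₂` are finitely generated,
`finrank_freeCohomology_two_eq_bettiNumber_of_finite` below).  Consequently no honest
`…_holds` can exist for that constant (a `_holds` proved under the statement file's `variable`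
instances would carry the extra binders `[T2Space M] [ChartedSpace (𝔼 4) M] [CompactSpace M]`,
i.e. prove a different, weaker statement); instead this file proves the statement the docstring and
the sources intend, under the new name
`Literature.Topology.FourManifolds.finrank_freeCohomology_two_eq_bettiNumber_of_compactSpace`, with
the manifold hypotheses as binders, and records that the mis-elaborated predicate holds at every
closed topological 4-manifold (`finrank_freeCohomology_two_eq_bettiNumber_of_chartedSpace`) and,
more generally, at every space with finitely generated `H₁(M; ℤ)` and `H₂(M; ℤ)`.  (The same defect
affects `isPerfPair_intersectionForm_four`, `sigPos_add_sigNeg_intersectionForm_four` and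
`nonempty_homotopyEquiv_iff_equivalent_intersectionForm` of that file; they are not treated here.)

## Source and proof

All the mathematics is the general theorem
`Literature.AlgebraicTopology.SingularHomology.finrank_freeCohomology_eq_bettiNumber_holds`
(`…SingularHomology.IntersectionFormProofs`): for a closed topological `n`-manifold `X`,
`rank (Hᵏ(X; ℤ)/T) = bₖ(X; ℚ)` in every degree — Hatcher 2002, §3.1 Cor. 3.3 (`rank Hᵏ = rank Hₖ`
for finitely generated `Hₖ`, `Hₖ₋₁`, via the Kronecker map: onto with torsion kernel), §3.A
Cor. 3A.6 (a) (`bₖ(X; ℤ) = bₖ(X; ℚ)`, flat base change `ℤ → ℚ` on singular chains) and App. A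
Cor. A.8–A.9 (homology of compact manifolds is finitely generated), all PROVED in the tree; here
`n = 4`, `k = 2` — exactly the interim proof preserved as a comment in the statement file.

## Main statements (all proved; no named fact, no statement modified)

* `finrank_freeCohomology_two_eq_bettiNumber_of_finite`: the identity for every space with
  finitely generated `H₁(M; ℤ)`, `H₂(M; ℤ)`.
* `finrank_freeCohomology_two_eq_bettiNumber_of_compactSpace`: **the corrected spc4.S08 rank
  statement** — `rank (H²(M; ℤ)/T) = b₂(M; ℚ)` for a closed topological 4-manifold `M : Type u`.
* `finrank_freeCohomology_two_eq_bettiNumber_of_chartedSpace`: the predicate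
  `finrank_freeCohomology_two_eq_bettiNumber (M := M)` of the statement file holds for every closed
  topological 4-manifold `M` (the form a consumer holding it as a hypothesis can use).

## References

* J. Milnor, D. Husemoller, *Symmetric Bilinear Forms*, Ergebnisse 73, Springer 1973, §V.1.
  [MilnorHusemoller1973]
* A. Hatcher, *Algebraic Topology*, CUP 2002, §3.1 Thm. 3.2 and Cor. 3.3 (p. 196), §3.3 p. 250,
  §3.A Cor. 3A.6 (a) (p. 264), App. A Cor. A.8–A.9 (p. 527); Moore spaces: §2.2 Example 2.40.
  [Hatcher2002]
-/

noncomputable section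

namespace Literature.Topology.FourManifolds

open Literature.AlgebraicTopology.SingularHomology

universe u

/-- **`rank (H²(M; ℤ)/T) = b₂(M; ℚ)` whenever `H₁(M; ℤ)` and `H₂(M; ℤ)` are finitely generated**,
for an arbitrary topological space `M` (Hatcher 2002, §3.1 Cor. 3.3: `H²(M; ℤ) ≅ (H₂/T₂) ⊕ T₁` has
rank `rank H₂`; §3.A Cor. 3A.6 (a): `rank H₂(M; ℤ) = dim_ℚ H₂(M; ℚ)`).  This is the exact range of
validity of the (mis-elaborated) predicate `finrank_freeCohomology_two_eq_bettiNumber`; from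
`finrank_singularCohomology_eq_finrank_singularHomology`, `bettiNumber_int_eq_rat` and
`finrank_quotient_torsion` of `…SingularHomology`. [cite: Hatcher2002, §3.1 Cor. 3.3 and §3.A Cor. 3A.6 (a)] -/
theorem finrank_freeCohomology_two_eq_bettiNumber_of_finite {M : Type u} [TopologicalSpace M]
    [Module.Finite ℤ ↥(singularHomology ℤ ℤ M 1)] [Module.Finite ℤ ↥(singularHomology ℤ ℤ M 2)] :
    finrank_freeCohomology_two_eq_bettiNumber (M := M) := by
  have h : ∀ m, m + 1 = 2 → Module.Finite ℤ ↥(singularHomology ℤ ℤ M m) := by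
    intro m hm
    obtain rfl : m = 1 := by omega
    infer_instance
  haveI : Module.Finite ℤ ↥(singularCohomology ℤ ℤ M 2) :=
    finite_singularCohomology_of_finite_singularHomology 2 h
  unfold finrank_freeCohomology_two_eq_bettiNumber
  rw [← bettiNumber_int_eq_rat, bettiNumber,
    ← finrank_singularCohomology_eq_finrank_singularHomology ℤ M 2 h]
  exact finrank_quotient_torsion

/-- **spc4.S08, rank part — the corrected statement, proved.**  For a closed topological
4-manifold `M` (`[T2Space M] [ChartedSpace (EuclideanSpace ℝ (Fin 4)) M] [CompactSpace M]`), the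
rank of the intersection lattice `H²(M; ℤ)/T` is the second Betti number:
`rank (H²(M; ℤ)/T) = b₂(M) = dim_ℚ H₂(M; ℚ)` (Milnor–Husemoller 1973, §V.1; Gompf–Stipsicz 1999,
§1.2: `rk Q_M = b₂(M)`).  This is what the named fact `finrank_freeCohomology_two_eq_bettiNumber`
of `IntersectionFormTopology.lean` intends; that constant, however, elaborates without its manifold
hypotheses (see the module docstring) and is false in that generality, so the intended statement is
vendored and PROVED here under a new name, with the hypotheses as binders.  The case `n = 4`,
`k = 2` of `Literature.AlgebraicTopology.SingularHomology.finrank_freeCohomology_eq_bettiNumber_holds`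
(universal coefficients, Hatcher 2002 Cor. 3.3 and Cor. 3A.6 (a), with Cor. A.8–A.9). [cite: MilnorHusemoller1973, §V.1] -/
theorem finrank_freeCohomology_two_eq_bettiNumber_of_compactSpace {M : Type u} [TopologicalSpace M]
    [T2Space M] [ChartedSpace (EuclideanSpace ℝ (Fin 4)) M] [CompactSpace M] :
    Module.finrank ℤ ↥(freeCohomology ℤ M 2) = bettiNumber ℚ M 2 :=
  finrank_freeCohomology_eq_bettiNumber_holds (n := 4) 2

/-- The predicate `finrank_freeCohomology_two_eq_bettiNumber (M := M)` of the statement file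
(spc4.S08, rank part: `rank (H²(M; ℤ)/T) = b₂(M; ℚ)`) **holds for every closed topological
4-manifold `M`** (Milnor–Husemoller 1973, §V.1) — the form in which a consumer holding the named
fact as a hypothesis `(h : finrank_freeCohomology_two_eq_bettiNumber (M := M))` for a closed
4-manifold discharges it.  Not named `…_holds`: the constant quantifies over all topological spaces,
where it fails (module docstring). [cite: MilnorHusemoller1973, §V.1] -/
theorem finrank_freeCohomology_two_eq_bettiNumber_of_chartedSpace {M : Type u} [TopologicalSpace M]
    [T2Space M] [ChartedSpace (EuclideanSpace ℝ (Fin 4)) M] [CompactSpace M] :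
    finrank_freeCohomology_two_eq_bettiNumber (M := M) :=
  finrank_freeCohomology_two_eq_bettiNumber_of_compactSpace

end Literature.Topology.FourManifolds

end
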